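import Literature.Computability.AlgebraicComplexity.BirkhoffShadow
import Summits.ValiantsHypothesis.ValiantsHypothesis.Theorems.LacunarySymmetroidMatrixDescartesCensusTropicalKLawStatic
import Summits.ValiantsHypothesis.ValiantsHypothesis.Theorems.KPlusLogSqLawTropicalBTwoRowSharpUnsigned

/-!
# Route «KPlusLogSqLaw», crux `TropicalB` (stmt-ValiantsHypothesis-19771) — a static dominant chain IS a set of vertices of an
# integral SEPARATING shadow of the Birkhoff polytope (bridge to `SeparatingShadowCeiling` / the Newton-polygon τ-conjecture)

HONEST FRAMING.  Def-free helper toward the registered stubs of the crux `TropicalB` (`--supports stmt-ValiantsHypothesis-19771`);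
nothing here asserts `TropicalB`, `KPlusLogSqLaw`, `MatrixDescartes` or anything on VP ≠ VNP.
THE BRIDGE (`exists_separating_shadow_of_static_chain`): a sign-alternating dominant chain of length `n + 1` of a STATIC design
of format `(m, K)` (one present class per entry = a linear parametric assignment instance on `m` nodes) yields an integral pair
`a b : Fin m × Fin m → ℕ` such that `ρ ↦ (∑_j a(ρ j, j), ∑_j b(ρ j, j))` SEPARATES the `m!` permutations and EVERY linear
`L : ℝ^{m×m} → ℝ²` sending the permutation matrix of `ρ` to that pair (e.g. the tree's `intProj a b`, `…Theorems.intProj_permMatrix`)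
has `n + 1 ≤ birkhoffShadowVertexCount L`.  Construction: `a` = entry exponents; `b = N·(valuation + shift + penalty·[dead entry])
+ 2^{idx(i,j)}` (binary gadget separating the permutation matrices, `N = ∑_{t<m²} 2^t + 1`); the `k`-th chain permutation is
strictly exposed by `(X, Y) ↦ N·θ_k·X − Y` (dominance + integrality give a unit gap, which times `N` absorbs the gadget), hence a
vertex (`mem_extremePoints_of_unique_max`).  USE (sequel `…TropicalBTowerLogOfNewtonTau`, importing `…SoloBlindShadowCeiling`): with
the same-size static reduction `TropicalCensus.tropRootLawAt_of_static`, `SeparatingShadowCeiling` (⇐ `KPTT.newtonTauWeak`;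
Hrubeš–Yehudayoff 2021 fn. 1 / Forbes) gives `log₂ T(m,K) = O(√m·log m + log K)` for EVERY `K`: the ATTACK FOOTHOLD `stub_tropTowerLog`
and the fat strip `K ≳ √m·log m` of `TropicalB` hold conditionally on `newtonTauWeak`, and refuting the foothold on `m = K log K`
nodes would refute `newtonTauWeak`.  [folklore] exposure ⇒ vertex; binary separation of permutation matrices.
-/

set_option linter.dupNamespace false
set_option autoImplicit false

namespace Summit.ValiantsHypothesis.ValiantsHypothesis.Theorems.KPlusLogSqLaw.ShadowCeilingBridge

open Summit.ValiantsHypothesis.ValiantsHypothesis.Theorems.MatrixDescartes.Negative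
open Summit.ValiantsHypothesis.ValiantsHypothesis.Theorems.LacunarySymmetroidMatrixDescartes.TropicalCensus
open Literature.Computability.AlgebraicComplexity (permMatrixPoints birkhoffShadowVertexCount)
open Finset

variable {m K : ℕ}

/-! ## 1. Static designs: a class selector `c` and the forced class map `j ↦ c (ρ j) j` of a permutation -/

/-- a CLASS SELECTOR exists: for every entry carrying a present class, `c i j` is such a class. [folklore] -/
theorem exists_selector (ε : Fin m → Fin m → Fin K → ℤ) (μ₀ : Fin m → Fin K) :
    ∃ c : Fin m → Fin m → Fin K, ∀ i j, (∃ l, ε i j l ≠ 0) → ε i j (c i j) ≠ 0 := by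
  classical
  refine ⟨fun i j => if h : ∃ l, ε i j l ≠ 0 then h.choose else μ₀ j, fun i j h => ?_⟩
  simp only [dif_pos h]
  exact h.choose_spec

/-- in a STATIC design every present class of an entry is the selected one. [folklore] -/
theorem eq_sel_of_ne_zero (ε : Fin m → Fin m → Fin K → ℤ) (hstat : IsStatic ε) {c : Fin m → Fin m → Fin K}
    (hc : ∀ i j, (∃ l, ε i j l ≠ 0) → ε i j (c i j) ≠ 0) {i j : Fin m} {l : Fin K} (hl : ε i j l ≠ 0) : l = c i j :=
  hstat i j l _ hl (hc i j ⟨l, hl⟩)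

/-- a present term of a static design is the FORCED term `(σ, j ↦ c (σ j) j)` of its permutation. [folklore] -/
theorem eq_forced_of_termSign_ne_zero (ε : Fin m → Fin m → Fin K → ℤ) (hstat : IsStatic ε) {c : Fin m → Fin m → Fin K}
    (hc : ∀ i j, (∃ l, ε i j l ≠ 0) → ε i j (c i j) ≠ 0) (q : Equiv.Perm (Fin m) × (Fin m → Fin K))
    (hq : termSign ε q ≠ 0) : q = (q.1, fun j => c (q.1 j) j) := by
  obtain ⟨σ, μ⟩ := q
  refine Prod.ext rfl ?_
  funext j
  exact eq_sel_of_ne_zero ε hstat hc (present_of_termSign_ne_zero ε (σ, μ) hq j)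

/-- if every entry of `ρ` is present, its forced term is present. [folklore] -/
theorem termSign_forced_ne_zero (ε : Fin m → Fin m → Fin K → ℤ) {c : Fin m → Fin m → Fin K}
    (hc : ∀ i j, (∃ l, ε i j l ≠ 0) → ε i j (c i j) ≠ 0) (ρ : Equiv.Perm (Fin m))
    (hρ : ∀ j, ∃ l, ε (ρ j) j l ≠ 0) : termSign ε (ρ, fun j => c (ρ j) j) ≠ 0 := by
  unfold termSign
  refine mul_ne_zero (Units.ne_zero _) ?_
  rw [prod_ne_zero_iff]
  intro j _
  exact hc _ _ (hρ j)

/-! ## 2. The binary gadget `2^{idx(i,j)}`, `idx (i, j) = finProdFinEquiv (i, j) < m·m`, separates the permutations -/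

/-- the entry index is injective. [folklore] -/
theorem idx_injective {i j i' j' : Fin m}
    (h : (finProdFinEquiv (i, j) : ℕ) = (finProdFinEquiv (i', j') : ℕ)) : i = i' ∧ j = j' := by
  have h1 : finProdFinEquiv (i, j) = finProdFinEquiv (i', j') := Fin.ext h
  have h2 := finProdFinEquiv.injective h1
  exact ⟨(Prod.ext_iff.mp h2).1, (Prod.ext_iff.mp h2).2⟩

/-- the gadget total of a permutation is the binary number whose digit set is its set of entry indices. [folklore] -/
theorem sum_gadget_eq (ρ : Equiv.Perm (Fin m)) :
    ∑ j, 2 ^ (finProdFinEquiv (ρ j, j) : ℕ) = ∑ t ∈ univ.image (fun j => (finProdFinEquiv (ρ j, j) : ℕ)), 2 ^ t := by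
  rw [sum_image]
  intro j _ j' _ h
  exact (idx_injective h).2

/-- the gadget total determines the permutation. [folklore] -/
theorem perm_eq_of_sum_gadget_eq {ρ ρ' : Equiv.Perm (Fin m)}
    (h : ∑ j, 2 ^ (finProdFinEquiv (ρ j, j) : ℕ) = ∑ j, 2 ^ (finProdFinEquiv (ρ' j, j) : ℕ)) : ρ = ρ' := by
  rw [sum_gadget_eq, sum_gadget_eq] at h
  have hset : univ.image (fun j => (finProdFinEquiv (ρ j, j) : ℕ)) = univ.image (fun j => (finProdFinEquiv (ρ' j, j) : ℕ)) := by
    rw [← Finset.toFinset_bitIndices_sum_two_pow (univ.image fun j => (finProdFinEquiv (ρ j, j) : ℕ)), h,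
      Finset.toFinset_bitIndices_sum_two_pow]
  ext j : 1
  have hj : (finProdFinEquiv (ρ j, j) : ℕ) ∈ univ.image (fun j => (finProdFinEquiv (ρ' j, j) : ℕ)) := by
    rw [← hset]; exact mem_image_of_mem _ (mem_univ j)
  obtain ⟨j', _, hj'⟩ := mem_image.mp hj
  obtain ⟨h1, h2⟩ := idx_injective hj'
  subst h2
  rw [h1]

/-- every gadget total is at most `∑_{t < m²} 2^t`. [folklore] -/
theorem sum_gadget_le (ρ : Equiv.Perm (Fin m)) :
    ∑ j, 2 ^ (finProdFinEquiv (ρ j, j) : ℕ) ≤ ∑ t ∈ range (m * m), 2 ^ t := by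
  rw [sum_gadget_eq]
  apply sum_le_sum_of_subset_of_nonneg
  · intro t ht
    obtain ⟨j, _, rfl⟩ := mem_image.mp ht
    exact mem_range.mpr (finProdFinEquiv (ρ j, j)).isLt
  · intros; positivity

/-! ## 3. From a static chain to a separating integral shadow with at least as many vertices -/

/-- **Unique maximiser ⇒ vertex.**  If a linear functional `l` attains its maximum over `S` at `x ∈ S` and at no other
point of `S`, then `x` is an extreme point of `conv S`. [folklore] -/
theorem mem_extremePoints_of_unique_max {E : Type*} [AddCommGroup E] [Module ℝ E] {S : Set E} {x : E} (hx : x ∈ S)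
    (l : E →ₗ[ℝ] ℝ) (hle : ∀ y ∈ S, l y ≤ l x) (huniq : ∀ y ∈ S, l y = l x → y = x) :
    x ∈ Set.extremePoints ℝ (convexHull ℝ S) := by
  -- `conv S` lies in the convex set `{x} ∪ {l < l x}`
  set B : Set E := {y | y = x ∨ l y < l x} with hB
  have hBconv : Convex ℝ B := by
    intro y₁ hy₁ y₂ hy₂ α β hα hβ hαβ
    have hval : l (α • y₁ + β • y₂) = α * l y₁ + β * l y₂ := by simp [map_add, map_smul, smul_eq_mul]
    have hx1 : α * l x + β * l x = l x := by rw [← add_mul, hαβ, one_mul]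
    rcases hα.lt_or_eq with hα | hα
    · rcases hβ.lt_or_eq with hβ | hβ
      · have h1 : l y₁ ≤ l x := by rcases hy₁ with h | h <;> [rw [h]; exact h.le]
        have h2 : l y₂ ≤ l x := by rcases hy₂ with h | h <;> [rw [h]; exact h.le]
        have h1' : α * l y₁ ≤ α * l x := mul_le_mul_of_nonneg_left h1 hα.le
        have h2' : β * l y₂ ≤ β * l x := mul_le_mul_of_nonneg_left h2 hβ.le
        rcases hy₁ with h | h
        · rcases hy₂ with h' | h'
          · left; rw [h, h', ← add_smul, hαβ, one_smul]
          · right; rw [hval]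
            have h3 : β * l y₂ < β * l x := mul_lt_mul_of_pos_left h' hβ
            linarith
        · right; rw [hval]
          have h3 : α * l y₁ < α * l x := mul_lt_mul_of_pos_left h hα
          linarith
      · subst hβ
        have : α = 1 := by linarith
        subst this
        simpa using hy₁
    · subst hα
      have : β = 1 := by linarith
      subst this
      simpa using hy₂
  have hSB : S ⊆ B := fun y hy => by
    by_cases h : y = x
    · exact Or.inl h
    · exact Or.inr (lt_of_le_of_ne (hle y hy) fun h' => h (huniq y hy h'))
  have hconvB : convexHull ℝ S ⊆ B := convexHull_min hSB hBconv
  have hle' : ∀ z ∈ convexHull ℝ S, l z ≤ l x := fun z hz => by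
    rcases hconvB hz with h | h
    · rw [h]
    · exact h.le
  rw [mem_extremePoints]
  refine ⟨subset_convexHull ℝ S hx, fun x₁ hx₁ x₂ hx₂ hseg => ?_⟩
  obtain ⟨α, β, hα, hβ, hαβ, hcomb⟩ := hseg
  have hval : l x = α * l x₁ + β * l x₂ := by
    rw [← hcomb]; simp [map_add, map_smul, smul_eq_mul]
  have h1 := hle' x₁ hx₁
  have h2 := hle' x₂ hx₂
  have hx1 : α * l x + β * l x = l x := by rw [← add_mul, hαβ, one_mul]
  have h1' : α * l x₁ ≤ α * l x := mul_le_mul_of_nonneg_left h1 hα.le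
  have h2' : β * l x₂ ≤ β * l x := mul_le_mul_of_nonneg_left h2 hβ.le
  have e1 : x₁ = x := by
    rcases hconvB hx₁ with h | h
    · exact h
    · exfalso
      have h3 : α * l x₁ < α * l x := mul_lt_mul_of_pos_left h hα
      linarith
  have e2 : x₂ = x := by
    rcases hconvB hx₂ with h | h
    · exact h
    · exfalso
      have h3 : β * l x₂ < β * l x := mul_lt_mul_of_pos_left h hβ
      linarith
  exact ⟨e1, e2⟩

/-- **THE BRIDGE.**  A sign-alternating dominant chain of length `n + 1` of a STATIC design of format `(m, K)` gives an
integral pair `(a, b)` separating the `m!` permutations such that every linear map sending the permutation matrix of `ρ` to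
`(∑_j a(ρ j, j), ∑_j b(ρ j, j))` (e.g. `intProj a b`) projects `DS_m` onto a polygon with at least `n + 1` vertices. [folklore] -/
theorem exists_separating_shadow_of_static_chain {n : ℕ} (d : Fin K → ℕ) (v ε : Fin m → Fin m → Fin K → ℤ)
    (θ : Fin (n + 1) → ℤ) (p : Fin (n + 1) → Equiv.Perm (Fin m) × (Fin m → Fin K)) (hstat : IsStatic ε)
    (hθ : StrictMono θ) (hdom : ∀ k, IsDominant d v ε (θ k) (p k))
    (halt : ∀ k : Fin n, termSign ε (p k.castSucc) * termSign ε (p k.succ) < 0) :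
    ∃ a b : Fin m × Fin m → ℕ,
      Function.Injective (fun ρ : Equiv.Perm (Fin m) => (∑ j, a (ρ j, j), ∑ j, b (ρ j, j))) ∧
      ∀ L : (Fin m × Fin m → ℝ) →ₗ[ℝ] (Fin 2 → ℝ),
        (∀ ρ : Equiv.Perm (Fin m), L (fun ij => if ρ ij.2 = ij.1 then 1 else 0) =
          fun i : Fin 2 => if i = 0 then ((∑ j, a (ρ j, j) : ℕ) : ℝ) else ((∑ j, b (ρ j, j) : ℕ) : ℝ)) →
        n + 1 ≤ birkhoffShadowVertexCount L := by
  classical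
  -- a class selector (junk classes taken from the first chain term) and the forced class maps
  obtain ⟨c, hc⟩ := exists_selector ε (p 0).2
  have hpk : ∀ k, p k = ((p k).1, fun j => c ((p k).1 j) j) := fun k =>
    eq_forced_of_termSign_ne_zero ε hstat hc (p k) (hdom k).1
  have hpres : ∀ k j, ∃ l, ε ((p k).1 j) j l ≠ 0 := fun k j => ⟨(p k).2 j, present_of_termSign_ne_zero ε (p k) (hdom k).1 j⟩
  -- the chain is injective, hence so is the chain of its permutations
  have hsucc : ∀ k : Fin n, p k.castSucc ≠ p k.succ := fun k h =>
    absurd (halt k) (by rw [h]; exact not_lt.mpr (mul_self_nonneg _))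
  have hpinj : Function.Injective p := injective_of_succ_ne d v ε θ p hθ hdom hsucc
  have hσinj : Function.Injective fun k => (p k).1 := by
    intro k k' h
    apply hpinj
    rw [hpk k, hpk k', show (p k).1 = (p k').1 from h]
  -- tropical weight of the forced term of a permutation
  set tw : ℤ → Equiv.Perm (Fin m) → ℤ := fun t ρ => tropWeight d v t (ρ, fun j => c (ρ j) j) with htw
  have htwk : ∀ k, tw (θ k) (p k).1 = tropWeight d v (θ k) (p k) := by
    intro k; simp only [htw]; rw [← hpk k]
  -- the penalty `W` exceeds every weight difference that occurs
  set W : ℤ := 1 + ∑ k, ∑ ρ, |tw (θ k) ρ - tw (θ k) (p k).1| with hW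
  have hWpos : 0 ≤ W := by
    have : 0 ≤ ∑ k, ∑ ρ, |tw (θ k) ρ - tw (θ k) (p k).1| := sum_nonneg fun k _ => sum_nonneg fun ρ _ => abs_nonneg _
    linarith
  have hWbig : ∀ k ρ, tw (θ k) ρ - tw (θ k) (p k).1 < W := by
    intro k ρ
    have h1 : |tw (θ k) ρ - tw (θ k) (p k).1| ≤ ∑ ρ', |tw (θ k) ρ' - tw (θ k) (p k).1| :=
      single_le_sum (f := fun ρ' => |tw (θ k) ρ' - tw (θ k) (p k).1|) (fun _ _ => abs_nonneg _) (mem_univ ρ)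
    have h2 : ∑ ρ', |tw (θ k) ρ' - tw (θ k) (p k).1| ≤ ∑ k', ∑ ρ', |tw (θ k') ρ' - tw (θ k') (p k').1| :=
      single_le_sum (f := fun k' => ∑ ρ', |tw (θ k') ρ' - tw (θ k') (p k').1|)
        (fun _ _ => sum_nonneg fun _ _ => abs_nonneg _) (mem_univ k)
    have h3 := le_abs_self (tw (θ k) ρ - tw (θ k) (p k).1)
    linarith
  -- entry data: exponent `a`, penalised valuation `cost = cv + pen`
  set a : Fin m × Fin m → ℕ := fun ij => d (c ij.1 ij.2) with ha
  set cv : Fin m × Fin m → ℤ := fun ij => v ij.1 ij.2 (c ij.1 ij.2) with hcv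
  set pen : Fin m × Fin m → ℤ := fun ij => if ∃ l, ε ij.1 ij.2 l ≠ 0 then 0 else W with hpen
  have hpen_nonneg : ∀ ij, 0 ≤ pen ij := by
    intro ij; simp only [hpen]; split_ifs
    · exact le_rfl
    · exact hWpos
  -- `θ·A − CV` is the tropical weight of the forced term
  have hF : ∀ (t : ℤ) (ρ : Equiv.Perm (Fin m)), t * ∑ j, (a (ρ j, j) : ℤ) - ∑ j, cv (ρ j, j) = tw t ρ := by
    intro t ρ
    simp only [htw, tropWeight, ha, hcv]
  have hpen_pres : ∀ ρ : Equiv.Perm (Fin m), (∀ j, ∃ l, ε (ρ j) j l ≠ 0) → ∑ j, pen (ρ j, j) = 0 := by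
    intro ρ hρ
    refine sum_eq_zero fun j _ => ?_
    simp only [hpen]
    rw [if_pos (hρ j)]
  have hpen_abs : ∀ ρ : Equiv.Perm (Fin m), (∃ j, ¬ ∃ l, ε (ρ j) j l ≠ 0) → W ≤ ∑ j, pen (ρ j, j) := by
    rintro ρ ⟨j₀, hj₀⟩
    have := single_le_sum (f := fun j => pen (ρ j, j)) (fun j _ => hpen_nonneg _) (mem_univ j₀)
    have e : pen (ρ j₀, j₀) = W := by simp only [hpen]; rw [if_neg hj₀]
    rw [e] at this
    exact this
  -- EXPOSURE GAP (integers): at slope `θ k` the chain permutation beats every other permutation by at least one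
  have hgap : ∀ k (ρ : Equiv.Perm (Fin m)), ρ ≠ (p k).1 →
      θ k * ∑ j, (a (ρ j, j) : ℤ) - (∑ j, cv (ρ j, j) + ∑ j, pen (ρ j, j)) + 1 ≤
        θ k * ∑ j, (a ((p k).1 j, j) : ℤ) - (∑ j, cv ((p k).1 j, j) + ∑ j, pen ((p k).1 j, j)) := by
    intro k ρ hρ
    rw [hpen_pres (p k).1 (hpres k), add_zero, hF (θ k) (p k).1, htwk k]
    by_cases hall : ∀ j, ∃ l, ε (ρ j) j l ≠ 0
    · rw [hpen_pres ρ hall, add_zero, hF (θ k) ρ]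
      have hne : (ρ, fun j => c (ρ j) j) ≠ p k := by
        intro h; apply hρ; rw [← h]
      have hlt := (hdom k).2 _ hne (termSign_forced_ne_zero ε hc ρ hall)
      simp only [htw]
      omega
    · have hall' : ∃ j, ¬ ∃ l, ε (ρ j) j l ≠ 0 := by
        by_contra hcon
        exact hall fun j => by_contra fun hj => hcon ⟨j, hj⟩
      have h1 := hpen_abs ρ hall'
      have h2 := hWbig k ρ
      have h3 := hF (θ k) ρ
      have h4 := htwk k
      omega
  -- shift the penalised valuations to naturals
  set S : ℤ := ∑ ij, |cv ij + pen ij| with hS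
  have hcostS : ∀ ij, 0 ≤ cv ij + pen ij + S := by
    intro ij
    have h1 : |cv ij + pen ij| ≤ S :=
      single_le_sum (f := fun ij => |cv ij + pen ij|) (fun _ _ => abs_nonneg _) (mem_univ ij)
    have h2 := neg_abs_le (cv ij + pen ij)
    linarith
  set b₀ : Fin m × Fin m → ℕ := fun ij => (cv ij + pen ij + S).toNat with hb₀
  have hb₀Z : ∀ ij, (b₀ ij : ℤ) = cv ij + pen ij + S := fun ij => Int.toNat_of_nonneg (hcostS ij)
  -- the gadget `g` and its scale `N` (made opaque once their two properties are recorded)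
  obtain ⟨g, N, hGlt, hGinj⟩ : ∃ (g : Fin m × Fin m → ℕ) (N : ℕ),
      (∀ ρ : Equiv.Perm (Fin m), ∑ j, g (ρ j, j) < N) ∧
      (∀ ρ ρ' : Equiv.Perm (Fin m), ∑ j, g (ρ j, j) = ∑ j, g (ρ' j, j) → ρ = ρ') :=
    ⟨fun ij => 2 ^ (finProdFinEquiv ij : ℕ), (∑ t ∈ range (m * m), 2 ^ t) + 1,
      fun ρ => Nat.lt_succ_of_le (sum_gadget_le ρ), fun ρ ρ' h => perm_eq_of_sum_gadget_eq h⟩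
  set b : Fin m × Fin m → ℕ := fun ij => N * b₀ ij + g ij with hb
  have hbsum : ∀ ρ : Equiv.Perm (Fin m), ∑ j, b (ρ j, j) = N * ∑ j, b₀ (ρ j, j) + ∑ j, g (ρ j, j) := by
    intro ρ
    simp only [hb]
    rw [sum_add_distrib, mul_sum]
  have hb₀sum : ∀ ρ : Equiv.Perm (Fin m),
      ((∑ j, b₀ (ρ j, j) : ℕ) : ℤ) = (∑ j, cv (ρ j, j) + ∑ j, pen (ρ j, j)) + m * S := by
    intro ρ
    push_cast
    simp only [hb₀Z]
    rw [sum_add_distrib, sum_add_distrib, sum_const, card_univ, Fintype.card_fin]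
    simp
  -- SEPARATION: the second coordinate alone determines the permutation
  have hsep : Function.Injective (fun ρ : Equiv.Perm (Fin m) => (∑ j, a (ρ j, j), ∑ j, b (ρ j, j))) := by
    intro ρ ρ' h
    have h2 : ∑ j, b (ρ j, j) = ∑ j, b (ρ' j, j) := (Prod.ext_iff.mp h).2
    rw [hbsum, hbsum] at h2
    have h3 : (∑ j, g (ρ j, j)) % N = (∑ j, g (ρ' j, j)) % N := by
      have := congrArg (· % N) h2
      simpa [Nat.mul_add_mod] using this
    rw [Nat.mod_eq_of_lt (hGlt ρ), Nat.mod_eq_of_lt (hGlt ρ')] at h3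
    exact hGinj ρ ρ' h3
  refine ⟨a, b, hsep, fun L hL => ?_⟩
  -- the exposing functionals `(X, Y) ↦ N·θ_k·X − Y`
  set E : Fin (n + 1) → (Fin 2 → ℝ) →ₗ[ℝ] ℝ :=
    fun k => (((N : ℝ) * θ k) • LinearMap.proj 0 - LinearMap.proj 1) with hE
  have hEval : ∀ (k : Fin (n + 1)) (ρ : Equiv.Perm (Fin m)),
      E k (L (fun ij => if ρ ij.2 = ij.1 then 1 else 0)) =
        (((N : ℤ) * (θ k * ∑ j, (a (ρ j, j) : ℤ) - (∑ j, cv (ρ j, j) + ∑ j, pen (ρ j, j))) - N * (m * S)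
          - ((∑ j, g (ρ j, j) : ℕ) : ℤ) : ℤ) : ℝ) := by
    intro k ρ
    rw [hL ρ, hbsum]
    simp only [hE, LinearMap.sub_apply, LinearMap.smul_apply, LinearMap.coe_proj, Function.eval, smul_eq_mul,
      Fin.isValue, ↓reduceIte]
    have e1 : (((∑ j, b₀ (ρ j, j) : ℕ) : ℤ) : ℝ) = (((∑ j, cv (ρ j, j) + ∑ j, pen (ρ j, j)) + m * S : ℤ) : ℝ) := by
      rw [hb₀sum]
    push_cast at e1 ⊢
    rw [e1]
    ring
  have hexpo : ∀ (k : Fin (n + 1)) (ρ : Equiv.Perm (Fin m)), ρ ≠ (p k).1 →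
      E k (L (fun ij => if ρ ij.2 = ij.1 then 1 else 0)) < E k (L (fun ij => if (p k).1 ij.2 = ij.1 then 1 else 0)) := by
    intro k ρ hρ
    rw [hEval, hEval]
    have h1 := hgap k ρ hρ
    have h2 : ((∑ j, g ((p k).1 j, j) : ℕ) : ℤ) < (N : ℤ) := Nat.cast_lt.mpr (hGlt (p k).1)
    have h3 : (0 : ℤ) ≤ ((∑ j, g (ρ j, j) : ℕ) : ℤ) := Nat.cast_nonneg _
    have key : (N : ℤ) * (θ k * ∑ j, (a (ρ j, j) : ℤ) - (∑ j, cv (ρ j, j) + ∑ j, pen (ρ j, j))) - N * (m * S)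
          - ((∑ j, g (ρ j, j) : ℕ) : ℤ)
        < (N : ℤ) * (θ k * ∑ j, (a ((p k).1 j, j) : ℤ) - (∑ j, cv ((p k).1 j, j) + ∑ j, pen ((p k).1 j, j))) - N * (m * S)
          - ((∑ j, g ((p k).1 j, j) : ℕ) : ℤ) := by
      nlinarith
    have key' := (Int.cast_lt (R := ℝ)).mpr key
    push_cast at key' ⊢
    linarith
  -- hence each chain permutation is a vertex of the shadow polygon
  set P : Set (Fin 2 → ℝ) := L '' permMatrixPoints m with hP
  have hPfin : P.Finite := by
    refine ((Set.finite_range fun ρ : Equiv.Perm (Fin m) =>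
      fun ij : Fin m × Fin m => if ρ ij.2 = ij.1 then (1 : ℝ) else 0).subset ?_).image _
    rintro x ⟨ρ, rfl⟩
    exact ⟨ρ, rfl⟩
  have hext : ∀ k, L (fun ij => if (p k).1 ij.2 = ij.1 then 1 else 0) ∈ Set.extremePoints ℝ (convexHull ℝ P) := by
    intro k
    refine mem_extremePoints_of_unique_max ⟨_, ⟨(p k).1, rfl⟩, rfl⟩ (E k) ?_ ?_
    · rintro y ⟨x, ⟨ρ, rfl⟩, rfl⟩
      by_cases hρ : ρ = (p k).1
      · rw [hρ]
      · exact (hexpo k ρ hρ).le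
    · rintro y ⟨x, ⟨ρ, rfl⟩, rfl⟩ hy
      by_contra hne
      have hρ : ρ ≠ (p k).1 := by
        rintro rfl; exact hne rfl
      exact absurd hy (hexpo k ρ hρ).ne
  -- distinct chain indices give distinct vertices
  have hvinj : Function.Injective fun k => L (fun ij => if (p k).1 ij.2 = ij.1 then 1 else 0) := by
    intro k k' h
    by_contra hkk
    have hne : (p k').1 ≠ (p k).1 := fun h' => hkk (hσinj h'.symm)
    have := hexpo k (p k').1 hne
    simp only at h
    rw [h] at this
    exact lt_irrefl _ this
  -- count
  have hEfin : (Set.extremePoints ℝ (convexHull ℝ P)).Finite := hPfin.subset extremePoints_convexHull_subset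
  set F : Finset (Fin 2 → ℝ) := univ.image fun k => L (fun ij => if (p k).1 ij.2 = ij.1 then 1 else 0) with hF
  have hFcard : F.card = n + 1 := by
    rw [hF, card_image_of_injective _ hvinj, card_univ, Fintype.card_fin]
  have hFsub : (F : Set (Fin 2 → ℝ)) ⊆ Set.extremePoints ℝ (convexHull ℝ P) := by
    intro y hy
    rw [hF, coe_image] at hy
    obtain ⟨k, _, rfl⟩ := hy
    exact hext k
  calc n + 1 = F.card := hFcard.symm
    _ = (F : Set (Fin 2 → ℝ)).ncard := (Set.ncard_coe_finset F).symm
    _ ≤ (Set.extremePoints ℝ (convexHull ℝ P)).ncard := Set.ncard_le_ncard hFsub hEfin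
    _ = birkhoffShadowVertexCount L := by rfl

/-- **Corollary (ceiling form).**  If every integral separating Birkhoff shadow on `m` nodes has at most `B + 1` vertices
(for all linear maps realising a separating integral pair), then `TropRootLawAtStatic m K B` for every `K`. [folklore] -/
theorem tropRootLawAtStatic_of_shadow_bound {m K B : ℕ}
    (h : ∀ a b : Fin m × Fin m → ℕ,
      Function.Injective (fun ρ : Equiv.Perm (Fin m) => (∑ j, a (ρ j, j), ∑ j, b (ρ j, j))) →
      ∃ L : (Fin m × Fin m → ℝ) →ₗ[ℝ] (Fin 2 → ℝ),
        (∀ ρ : Equiv.Perm (Fin m), L (fun ij => if ρ ij.2 = ij.1 then 1 else 0) =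
          fun i : Fin 2 => if i = 0 then ((∑ j, a (ρ j, j) : ℕ) : ℝ) else ((∑ j, b (ρ j, j) : ℕ) : ℝ)) ∧
        birkhoffShadowVertexCount L ≤ B + 1) :
    TropRootLawAtStatic m K B := by
  intro d v ε n θ p _hε hstat hθ hdom halt
  obtain ⟨a, b, hsep, hL⟩ := exists_separating_shadow_of_static_chain d v ε θ p hstat hθ hdom halt
  obtain ⟨L, hLr, hLB⟩ := h a b hsep
  have := hL L hLr
  omega

end Summit.ValiantsHypothesis.ValiantsHypothesis.Theorems.KPlusLogSqLaw.ShadowCeilingBridge
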